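import Summits.BirchSwinnertonDyer.BirchSwinnertonDyer.Theorems.EisensteinPrimesMazurMCOnCellBTwistbackLamOneRankOne
import Summits.BirchSwinnertonDyer.BirchSwinnertonDyer.Theorems.EisensteinPrimesMazurMCOnCellBTwistbackOnePartnerCertificates
import Literature.NumberTheory.EllipticCurves.KatoRankBoundMultiplicativeProofs
import HarnessLib

/-!
# Crux 3 `MazurMCOnCellB` (stmt-BirchSwinnertonDyer-19033), line `twistback` v4 — road (c′): the partner's ANALYTIC
# RANK from the `L`-function certificate `ord_{T=0} L_p(E^K, T) = 1` (every non-split X2b pair, any local balance)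

Width seat bsd-line-x2-p1-w5 (g0), 2026-08-28; sequel of `…TwistbackLamOneRankOne` (p649897). HONEST FRAMING (cell
`bsd-eis`, run/shared/lean/pub/bsd-eis/): conditional theorems only. Named facts BY NAME: Wuthrich 2014 Thm. 16, the
parametrisation supply and modularity (conjuncts of the route's `PublishedInputs`, stmt-…-19037), Disegni 2020 Thm. 4(1)
(`padicBSD_rankOne_nonsplitMult`, PUB), Dokchitser–Dokchitser 2010 Thm. 1.4 (`selmerCorank_mod_two_eq`, PUB), and
Keller–Yin 2024 Thm. E multiplicative half (`thmE_pConverse_semistable_OPEN`, UNREFEREED PREPRINT resting on Castella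
arXiv:2409.01360 — every theorem below is conditional on that OPEN claim; the line already carries Keller–Yin Thm. D,
PRE). No `def`, no `sorry`; no main conjecture / BSD proved for any curve unconditionally; 0 cells / labels / stubs /
tiers move.

WHY. Road (d′) (p649897/p650387/`…LamOneMazurMC`) serves the sub-row of local balance `1` through `(μ_an, λ_an) = (0,1)`.
On the other non-split X2b rows (`c(E) ≥ 3`: 14/44 census cells) `λ_an(E^K) ≥ 3` at every admissible partner, and the
LEAD's per-pair road (c) (p640749 §3(i)/§4: ONE admissible `K` with `ord_{T=0} L_p(E^{(d_K)}, T) = 1` for THE non-split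
Mazur–Tate–Teitelbaum function) is the door — which also asked for `hrd : r_an(E^{(d_K)}) = 1`. The same squeeze removes
it: Kato's Thm. 18.4 in Wuthrich's reducible form (tree THEOREM
`Wuthrich2014.thm16_charIdeal_dvd_multiplicative_of_reducible.selmerCorank_le_order`: `corank Sel_{p^∞}(E/ℚ) ≤ ord_{T=0} L`)
gives corank `≤ 1` from the certificate, `p`-parity and the odd analytic rank of a Heegner twist give `= 1`, and Keller–Yin
Thm. E gives `r_an = 1`. Since `ord_{T=0} ≤ λ`, this is the WEAKER per-pair hypothesis; it covers every non-split X2b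
pair for which one admissible twist has a simple zero of `L_p` at `T = 0`.

* §1 `analyticRank_eq_one_of_orderOne_of_odd` — `W` globally minimal, `p ≠ 2` NON-split multiplicative, `E[p]` reducible,
  `r_an(W)` odd, `ord_{T=0} L = 1` for THE non-split function of every newform/`ϖ` of `W` ⟹ `r_an(W) = 1`.
* §2 `mazurMainConjectureAt_of_cellB_of_not_split_of_indexLowerBoundAt_of_orderOne_twist_of_thmE` — p640749 §4
  `…_of_orderOne_twist` VERBATIM with `hrd` REMOVED (+ `hDD`, `hKY`).

References: [Kato2004Asterisque] Thm. 18.4; [Wuthrich2014] Thm. 16; [GreenbergLNM1716] §3 Lemma 3.1;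
[DokchitserDokchitserAnnals2010] Thm. 1.4; [KellerYin2024] Thm. E (PRE); [Disegni2020] Thm. 4; [SteinWuthrich2013] Thm. 6.1;
[JetchevSkinnerWan2017] §7.4.1.
-/

set_option autoImplicit false

-- `Summit.BirchSwinnertonDyer.BirchSwinnertonDyer.…`: the summit and its single sub-problem share a name.
set_option linter.dupNamespace false

noncomputable section

open scoped Classical MatrixGroups ModularForm

open CongruenceSubgroup WeierstrassCurve NumberField IsDedekindDomain Field
  Literature.NumberTheory.EllipticCurves
  Literature.NumberTheory.GaloisRepresentations
  Literature.NumberTheory.EllipticCurves.ModularForms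
  Literature.NumberTheory.EllipticCurves.Rank1Residual
  Literature.NumberTheory.EllipticCurves.Rank1Residual.Typed
  Literature.NumberTheory.EllipticCurves.Wuthrich2014
  Literature.NumberTheory.EllipticCurves.Disegni2020
  Literature.NumberTheory.EllipticCurves.KellerYin2024
  Summit.BirchSwinnertonDyer.Rank1Residual
  Summit.BirchSwinnertonDyer.Rank1Residual.X2
  Summit.BirchSwinnertonDyer.BirchSwinnertonDyer.Theses
  Summit.BirchSwinnertonDyer.BirchSwinnertonDyer.Theorems.EisensteinPrimesMazurMCOnCellBTwistbackOnePartnerCertificates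
  Summit.BirchSwinnertonDyer.BirchSwinnertonDyer.Theorems.EisensteinPrimesMazurMCOnCellBTwistbackLamOneRankOne

namespace Summit.BirchSwinnertonDyer.BirchSwinnertonDyer.Theorems.EisensteinPrimesMazurMCOnCellBTwistbackOrderOneRankOne

/-! ## §1. `ord_{T=0} L_p(E, T) = 1` ∧ `r_an` odd ⟹ `ord_{s=1} L(E, s) = 1` at a non-split multiplicative Eisenstein prime -/

/-- **Road (c′), core: the `L`-function certificate gives the analytic rank.** Data: `W/ℚ` globally minimal, `p ≠ 2` of
NON-split multiplicative reduction, `E[p]` reducible, `ord_{s=1} L(E, s)` odd, and `ord_{T=0} L = 1` for THE non-split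
Mazur–Tate–Teitelbaum function `L` of every newform `f` of `W` and `ϖ` with `ϖ·Ω_E = Ω⁺_f` (the per-pair certificate
`hordL` of p640749). Then `corank_{ℤ_p} Sel_{p^∞}(E/ℚ) ≤ ord_{T=0} L = 1` (Kato Thm. 18.4 via Wuthrich Thm. 16, tree theorem
`Wuthrich2014.thm16_charIdeal_dvd_multiplicative_of_reducible.selmerCorank_le_order`; instantiated at the newform of a
parametrisation datum, `hpar`, and THE non-split function, `exists_isMultPAdicLFunctionOf_neg_one_of_nonsplit`), `= 1` by
`p`-parity (`hDD`, Dokchitser–Dokchitser Thm. 1.4), and `ord_{s=1} L(E, s) = 1` by Keller–Yin Thm. E (`hKY`, PRE).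
[claim: KellerYin2024, status: under-review] [cite: Kato2004Asterisque, Thm. 18.4 (p. 281)]
[cite: Wuthrich2014, Thm. 16 (p. 397)] [cite: DokchitserDokchitserAnnals2010, Thm. 1.4] -/
theorem analyticRank_eq_one_of_orderOne_of_odd (hWu : thm16_charIdeal_dvd_multiplicative_of_reducible)
    (hpar : nonempty_modularParametrizationData) (hKY : thmE_pConverse_semistable_OPEN)
    (W : WeierstrassCurve ℚ) [W.IsElliptic] [W.IsGloballyMinimal] (p : ℕ) [Fact p.Prime]
    (hDD : selmerCorank_mod_two_eq W p)
    (hp2 : p ≠ 2) (hmult : W.HasMultiplicativeReductionAtPrime p)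
    (hns : ¬ W.HasSplitMultiplicativeReductionAtPrime p) (hred : ¬ W.HasIrreducibleModPGaloisRep p)
    (hodd : Odd W.analyticRank)
    (hordL : ∀ {N : ℕ} [NeZero N] (f : CuspForm (Gamma0 N) 2), IsNewformOf W f →
      ∀ (ϖ : ℚ), (ϖ : ℝ) * W.realPeriodRat = plusPeriod f →
      ∀ L : PowerSeries ℚ_[p], IsMultPAdicLFunctionOf f p (-1) L → L.order = ((1 : ℕ) : ℕ∞)) :
    W.analyticRank = 1 := by
  have hpP : p.Prime := Fact.out
  have hp : 2 < p := lt_of_le_of_ne hpP.two_le (Ne.symm hp2)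
  -- a newform with its `ϖ` and THE non-split `p`-adic `L`-function
  haveI : NeZero (W.conductorNorm ℤ) := ⟨(W.conductorNorm_pos_holds).ne'⟩
  obtain ⟨Dm⟩ := hpar W
  obtain ⟨ϖ, -, hϖ, -⟩ := Dm.exists_rat_mul_realPeriodRat_eq_plusPeriod
  obtain ⟨L, hL⟩ := exists_isMultPAdicLFunctionOf_neg_one_of_nonsplit Dm.isNewformOf hmult hns
  -- Kato–Wuthrich: `corank Sel ≤ ord_{T=0} L = 1`
  have hle : (W.selmerCorank p : ℕ∞) ≤ L.order :=
    (Wuthrich2014.thm16_charIdeal_dvd_multiplicative_of_reducible.selmerCorank_le_order W p hWu hp2 hmult hred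
      Dm.isNewformOf ϖ hϖ).1 hns L hL
  rw [hordL Dm.f Dm.isNewformOf ϖ hϖ L hL] at hle
  have hle1 : W.selmerCorank p ≤ 1 := by exact_mod_cast hle
  -- parity: the corank is odd, hence `1`
  have hmod : W.selmerCorank p % 2 = W.analyticRank % 2 := hDD
  have hcork : W.selmerCorank p = 1 := by
    rcases hodd with ⟨k, hk⟩
    omega
  -- Keller–Yin Thm. E, multiplicative half
  exact hKY W p hp (Or.inr hmult) hred 1 (Or.inr rfl) hcork

/-! ## §2. PER PAIR, NON-SPLIT X2b: Mazur's MC from STEP L and `ord_{T=0} L_p(E^K, T) = 1` — no `hrd` -/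

/-- **PER PAIR, NON-SPLIT, `L`-function-certificate form WITHOUT the analytic rank of the partner**: p640749 §4
`mazurMainConjectureAt_of_cellB_of_not_split_of_indexLowerBoundAt_of_orderOne_twist` VERBATIM with its hypothesis
`hrd : Wd.analyticRank = 1` REMOVED and two named facts added — `hDD : selmerCorank_mod_two_eq Wd p` (PUB) and
`hKY : KellerYin2024.thmE_pConverse_semistable_OPEN` (PRE): Mazur's main conjecture at a non-split X2b pair `(W, p)` from
STEP L over `K` at ONE Heegner datum with `p ∤ c` (`hlow`) and ONE admissible `K` whose twist's minimal model `Wd` has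
`ord_{T=0} L_p(Wd, T) = 1` (`hordL`). The twist is non-split multiplicative at `p` with `E[p]` reducible and odd analytic
rank (`r_an(E) = 0`, Heegner sign; p649897 `odd_analyticRank_quadraticTwist_of_analyticRank_eq_zero`), so §1 gives `hrd`.
Serves EVERY non-split X2b row (any local balance). [claim: KellerYin2024, status: under-review]
[cite: Disegni2020, Thm. 4 (§3.2)] [cite: SteinWuthrich2013, Thm. 6.1 (p. 20), §4.2] [cite: GreenbergVatsal2000, Thm. (1.3) with pp. 14–15]
[cite: Wuthrich2014, Thm. 16 (p. 397)] [cite: JetchevSkinnerWan2017, §7.4.1] [cite: DokchitserDokchitserAnnals2010, Thm. 1.4] -/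
theorem mazurMainConjectureAt_of_cellB_of_not_split_of_indexLowerBoundAt_of_orderOne_twist_of_thmE
    (hP : EisensteinPrimes.PublishedInputs) (hDis : padicBSD_rankOne_nonsplitMult)
    (hKY : thmE_pConverse_semistable_OPEN)
    (W : WeierstrassCurve ℚ) [W.IsElliptic] [W.IsGloballyMinimal] (p : ℕ) [Fact p.Prime]
    (hc : X2.CellB W p) (hns : ¬ W.HasSplitMultiplicativeReductionAtPrime p)
    (N : ℕ) [NeZero N] (K : Type) [Field K] [NumberField K]
    (Dt : ModularParametrizationData W N) (H : HeegnerDatum N (NumberField.discr K)) (ι : K →+* ℂ)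
    (P : (W.baseChange K).toAffine.Point)
    (hK : IsImaginaryQuadratic K) (hodd : Odd (NumberField.discr K)) (hlt : NumberField.discr K < -4)
    (hN : W.conductorNorm ℤ = N) (hHN : SatisfiesHeegnerHypothesis N K)
    (hHp : SatisfiesHeegnerHypothesis p K)
    (hPt : WeierstrassCurve.Affine.Point.map ι.toRatAlgHom P = heegnerPointComplex Dt H)
    (hcM : ¬ (p : ℤ) ∣ Dt.c)
    (Wd : WeierstrassCurve ℚ) [Wd.IsElliptic] [Wd.IsGloballyMinimal]
    (hWd : ∃ C : VariableChange ℚ, C • Wd = W.quadraticTwist (NumberField.discr K : ℚ))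
    (hDD : selmerCorank_mod_two_eq Wd p)
    (hlow : Finite (W.baseChange K).sha → X11b.IndexLowerBoundAt W p K P)
    (hordL : ∀ {M : ℕ} [NeZero M] (f : CuspForm (Gamma0 M) 2), IsNewformOf Wd f →
      ∀ (ϖ : ℚ), (ϖ : ℝ) * Wd.realPeriodRat = plusPeriod f →
      ∀ L : PowerSeries ℚ_[p], IsMultPAdicLFunctionOf f p (-1) L → L.order = ((1 : ℕ) : ℕ∞)) :
    X2.MazurMainConjectureAt W p := by
  have hpar := hP.2.2.2.2.1
  have hnf := hP.2.2.2.2.2.1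
  have hWu := hP.2.2.2.2.2.2.2.2.2.2.2.2.2.2.1
  have hp2 : p ≠ 2 := hc.2.1.1
  have hmult : W.HasMultiplicativeReductionAtPrime p := hc.2.1.2.2
  have hr0 : W.analyticRank = 0 := hc.1
  obtain ⟨C, hC⟩ := hWd
  have hXd : ClassX2 Wd p := X2.classX2_twist W p hc.2.1 K hK hHp Wd ⟨C, hC⟩
  have hnsd : ¬ Wd.HasSplitMultiplicativeReductionAtPrime p := fun hs ↦
    hns ((X2.hasSplitMultiplicativeReductionAtPrime_iff_of_smul_eq_quadraticTwist W Wd hK p hp2 hmult hHp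
      hC).mp hs)
  have hHW : SatisfiesHeegnerHypothesis (W.conductorNorm ℤ) K := by rw [hN]; exact hHN
  have hoddd : Odd Wd.analyticRank := by
    have h := congrArg WeierstrassCurve.analyticRank hC
    rw [analyticRank_smul] at h
    rw [h]
    exact EisensteinPrimesMazurMCOnCellBTwistbackLamOneRankOne.odd_analyticRank_quadraticTwist_of_analyticRank_eq_zero
      hnf W hr0 K hK hHW
  have hrd : Wd.analyticRank = 1 :=
    analyticRank_eq_one_of_orderOne_of_odd hWu hpar hKY Wd p hDD hp2 hXd.2.2 hnsd hXd.2.1 hoddd hordL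
  exact EisensteinPrimesMazurMCOnCellBTwistbackOnePartnerCertificates.mazurMainConjectureAt_of_cellB_of_not_split_of_indexLowerBoundAt_of_orderOne_twist
    hP hDis W p hc hns N K Dt H ι P hK hodd hlt hN hHN hHp hPt hcM Wd ⟨C, hC⟩ hrd hlow hordL

end Summit.BirchSwinnertonDyer.BirchSwinnertonDyer.Theorems.EisensteinPrimesMazurMCOnCellBTwistbackOrderOneRankOne

end
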